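import Summits.QuantumFields.BalabanUV.T4Continuum.Support.NE7OpenOfMinimisation
import Summits.QuantumFields.BalabanUV.T4Continuum.Support.NE7SymmetricFibreLHC
import Summits.QuantumFields.BalabanUV.T4Continuum.Support.NE7StabiliserLiftingPrep
import HarnessLib

/-!
# NE7SymmetricOpenOfMinimisation — (OPEN_K) OF THE SYMMETRIC CONTINUITY METHOD BY RESTRICTED MINIMISATION: near a parameter carrying a small tangent-critical
# configuration FIXED by the lifts of `K`, RESTRICTED minimisers (over the `K̂`-fixed admissible configurations) exist, stay away from the class boundary, and are
# therefore tangent-critical (restricted Fermat + Palais) — so (OPEN_K) ⇐ (APE) ∧ (ALL-SMALL), THE ROAD's OWN TWO LETTERS, VERBATIM (file S2 of the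
# `k`-uniform stabiliser lifting programme; F27 `NE7OpenOfMinimisation` re-run inside `Fix(K̂)`)

Cell `pub-balaban`, rung (B)+1 sub-cell t4, lineage `b2b-balaban-t4-ne7b-p1` (row NE7b OWNER + CRUX PROVER; junction service for row NE7, ruling
R-OWNER-149-1 (2)), generation 159.  Memo `t4/b2b-balaban-t4-ne7b-p1/g159/records/SCOPING-uniform-lifting.md` §3 (S2); serves the END ✓ p828980
`NE7StabiliserLiftingUniformEnd.fixed_minimiser_of_open_path` (its letter (OPEN_K) is `symmetric_hopen_of_ape_allSmall`'s conclusion).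
THE ARGUMENT = F27's (A)(B)(C)(D) with ONE change.  Level `k+1`, data path `γ` (continuous on `[0,1]`, unitary `N`-periodic values FIXED by every `s ∈ K`), radii
`r₁ < r <` class radius.  At `τ₀`: `U₀` admissible, `SmallField U₀ r₁`, fixed by the lifts `ŝ`, and ALL-SMALL (every admissible `U` with `levelAction U ≤ levelAction U₀`
is `SmallField · r₁` — the road's letter, about ALL admissible `U`).  (A) on `admissible(γ τ₀) ∩ Bad` the action is `≥ m₀ + ε′` — VERBATIM; (B) the parameters carrying
an admissible `U ∈ Bad` with `levelAction U ≤ m₀ + ε′∕2` form a closed set not containing `τ₀` — VERBATIM (F18 ✓ `isClosed_critSet_param'`); (C) THE CHANGE: by the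
SYMMETRIC lower hemicontinuity ✓ `NE7SymmetricFibreLHC.symmetric_admissible_lhc_param`, for `τ` near `τ₀` some `K̂`-FIXED admissible `V_τ` has `levelAction V_τ <
m₀ + ε′∕2`; (D) hence the `K̂`-fixed admissible set over `γ τ` is non-empty and compact (✓ `isCompact_admissible` ∩ ✓ `isClosed_fixedSet`), a RESTRICTED minimiser
`U_τ` EXISTS, `levelAction U_τ < m₀ + ε′∕2`, so `U_τ ∉ Bad`, i.e. `SmallField U_τ r`; being interior, `U_τ` is tangent-critical by restricted Fermat + Palais
(✓ p824826 `NE7StabiliserLiftingPrep.tanCritical_of_symmetricRestrictedMinimiser`).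
WHAT ([folklore]; 0 def, 0 sorry; generic `d`, every `U(n)`, `L ≥ 2`).  **`exists_fixedMinimiser_small_near`** ((A)–(D)); **`symmetric_open_of_ape_allSmall`** ((OPEN_K) at
one `τ₀` from (APE at `τ₀`) ∧ (ALL-SMALL at `τ₀`)); **`symmetric_hopen_of_ape_allSmall`** — the (OPEN_K) binder of ✓ `NE7StabiliserLiftingUniformEnd.fixedCrit_of_continuity` ∕
`fixed_minimiser_of_open_path` from (APE)^path ∧ (ALL-SMALL)^path, the SAME letters as F27's `hopen_of_ape_allSmall` (discharged along small data by the road's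
✓ `critical_iff_minimiser_generic` + ✓ `all_minimisers_small_generic`, `k`-free radius).
HONEST FRAMING (page 1).  Soft topology (compactness, Berge) + gen 158's restricted Fermat and the symmetric fibre-LHC; (APE) and (ALL-SMALL) are HYPOTHESES
asserted for nothing; NOT the uniform lifting (the letter (PATH_K) — a symmetric small-data path from a symmetric flat datum — remains), NOT NE7, NOT NE3; row
NE7b NOT PRINTED ∕ NOT PROVED; spine 0∕9; finite T⁴ rung (B)+1 — NOT infinite volume, NOT mass gap, NOT BetaPertH, NOT Clay (continuum YM on T⁴ ⇐ BetaPertH ∧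
nine spine estimates).
-/

set_option autoImplicit false

open scoped BigOperators Matrix Matrix.Norms.L2Operator Topology
open NormedSpace Finset Set Filter

namespace Summit.QuantumFields.BalabanUV.T4Continuum.NE7SymmetricOpenOfMinimisation

open Literature.MathematicalPhysics.QuantumFieldTheory.Balaban1983to89
open B7Prop1Explicit B7Prop2Explicit MatrixLog UnitaryModel
open T4AveragingDeficitWall (IsUnitaryCfg IsSkewDir SmallField)
open T4AveragingDeficitWallBoundary (IsPeriodicCfg periodBox)
open AveragingDeficitPeriodicCounting (IsPeriodicDir)
open AveragingDeficitMultiLevelPrep (LevelSmall TangentIter)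
open MinimalActionLevels (levelAction perWin)
open MinimalActionSandwich (IsMinimiser admissible)
open MinimalActionRate (sfClass)
open MinimalActionCompact (isCompact_sfClass continuous_levelAction)
open MinimalActionExistence (isCompact_admissible)
open NE3HessForm (dAction)
open NE3EnergyShapes (IsUnitarySite IsPeriodicSite)
open NE7CritClosed (isClosed_critSet_param')
open NE7OpenOfMinimisation (smallField_of_window isOpen_goodSet)
open NE7SymmetricAdmissibleWitness (isClosed_fixedSet)
open NE7SymmetricFibreLHC (symmetric_admissible_lhc_param)
open NE7StabiliserLiftingPrep (tanCritical_of_symmetricRestrictedMinimiser)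

noncomputable section

variable {d : ℕ} {n : Type*} [Fintype n] [DecidableEq n]

/-- **RESTRICTED MINIMISERS NEAR `τ₀` EXIST AND ARE SMALL** (F27's `exists_minimiser_small_near` inside `Fix(K̂)`; steps (A)–(D) of the module docstring).  Level
`k+1` of `sfClass d L N ε` (`L ≥ 2`, `N ≥ 1`, `16C₀ε ≤ 3`, `1024(d+1)(d+4)L²ε ≤ 1`, `LevelSmall d L k (ε(L^{k+1})^{−2})`); `K` a set of unitary `N`-periodic coarse
gauge fields; `γ` continuous on `[0,1]` with unitary `N`-periodic `K`-FIXED values; radii `r₁ < r`, `r₁ < ε(L^{k+1})^{−2}`; at `τ₀ ∈ [0,1]`: `U₀ ∈ admissible … (γ τ₀)`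
FIXED by the lifts of `K`, with `SmallField U₀ r₁` and ALL-SMALL.  THEN `∃ ρ > 0`, for `τ ∈ [0,1]`, `|τ − τ₀| < ρ`: a minimiser of the level action over the
`K̂`-FIXED admissible configurations at the datum `γ τ` exists, and every such restricted minimiser is `SmallField · r`. [folklore] -/
theorem exists_fixedMinimiser_small_near [Nonempty n] {L N k : ℕ} [NeZero L] [NeZero N] (hL : 2 ≤ L) {ε r r₁ : ℝ} (hε0 : 0 ≤ ε)
    (hε1 : 16 * C0 d * ε ≤ 3) (hε2 : 1024 * (d + 1) * (d + 4) * (L : ℝ) ^ 2 * ε ≤ 1) (hls : LevelSmall d L k (ε / ((L : ℝ) ^ (k + 1)) ^ 2))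
    (hr₁r : r₁ < r) (hr₁ε : r₁ < ε / ((L : ℝ) ^ (k + 1)) ^ 2)
    (K : Set (Site d → (Matrix n n ℂ)ˣ)) (hKu : ∀ s ∈ K, IsUnitarySite s) (hKP : ∀ s ∈ K, IsPeriodicSite s (N : ℤ))
    (γ : ℝ → (Site d → Fin d → (Matrix n n ℂ)ˣ)) (hγ : ContinuousOn γ (Icc (0 : ℝ) 1)) (hγu : ∀ τ ∈ Icc (0 : ℝ) 1, IsUnitaryCfg (γ τ))
    (hγP : ∀ τ ∈ Icc (0 : ℝ) 1, IsPeriodicCfg (γ τ) (N : ℤ)) (hγK : ∀ τ ∈ Icc (0 : ℝ) 1, ∀ s ∈ K, gaugeAct s (γ τ) = γ τ)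
    {τ₀ : ℝ} (hτ₀ : τ₀ ∈ Icc (0 : ℝ) 1)
    {U₀ : Site d → Fin d → (Matrix n n ℂ)ˣ} (hU₀ : U₀ ∈ admissible (sfClass d L N ε) L (k + 1) (γ τ₀)) (hU₀r₁ : SmallField U₀ r₁)
    (hU₀fix : ∀ s ∈ K, gaugeAct (fun x : Site d => s (fun i => x i / ((L : ℤ) ^ (k + 1)))) U₀ = U₀)
    (hall : ∀ U ∈ admissible (sfClass d L N ε) L (k + 1) (γ τ₀), levelAction d L N (k + 1) U ≤ levelAction d L N (k + 1) U₀ → SmallField U r₁) :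
    ∃ ρ : ℝ, 0 < ρ ∧ ∀ τ ∈ Icc (0 : ℝ) 1, |τ - τ₀| < ρ →
      (∃ U, U ∈ admissible (sfClass d L N ε) L (k + 1) (γ τ) ∧
        (∀ s ∈ K, gaugeAct (fun x : Site d => s (fun i => x i / ((L : ℤ) ^ (k + 1)))) U = U) ∧
        ∀ U' ∈ admissible (sfClass d L N ε) L (k + 1) (γ τ),
          (∀ s ∈ K, gaugeAct (fun x : Site d => s (fun i => x i / ((L : ℤ) ^ (k + 1)))) U' = U') →
            levelAction d L N (k + 1) U ≤ levelAction d L N (k + 1) U') ∧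
      ∀ U, U ∈ admissible (sfClass d L N ε) L (k + 1) (γ τ) →
        (∀ s ∈ K, gaugeAct (fun x : Site d => s (fun i => x i / ((L : ℤ) ^ (k + 1)))) U = U) →
        (∀ U' ∈ admissible (sfClass d L N ε) L (k + 1) (γ τ),
          (∀ s ∈ K, gaugeAct (fun x : Site d => s (fun i => x i / ((L : ℤ) ^ (k + 1)))) U' = U') →
            levelAction d L N (k + 1) U ≤ levelAction d L N (k + 1) U') → SmallField U r := by
  have hL1 : 1 ≤ L := by omega
  set Pd : ℕ := N * L ^ (k + 1) with hPd
  haveI : NeZero Pd := ⟨Nat.mul_ne_zero (NeZero.ne N) (pow_ne_zero _ (NeZero.ne L))⟩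
  set f : (Site d → Fin d → (Matrix n n ℂ)ˣ) → ℝ := fun U => levelAction d L N (k + 1) U with hfdef
  have hfc : Continuous f := continuous_levelAction (d := d) (n := n) L N (k + 1)
  set m₀ : ℝ := f U₀ with hm₀
  -- the lifted set of gauge fields and the fixed set
  set 𝒲 : Set (Site d → (Matrix n n ℂ)ˣ) :=
    (fun s : Site d → (Matrix n n ℂ)ˣ => fun x : Site d => s (fun i => x i / ((L : ℤ) ^ (k + 1)))) '' K with h𝒲
  have hfixW : ∀ U : Site d → Fin d → (Matrix n n ℂ)ˣ,
      (∀ w ∈ 𝒲, gaugeAct w U = U) ↔ ∀ s ∈ K, gaugeAct (fun x : Site d => s (fun i => x i / ((L : ℤ) ^ (k + 1)))) U = U := by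
    intro U
    constructor
    · intro h s hs
      exact h _ ⟨s, hs, rfl⟩
    · rintro h w ⟨s, hs, rfl⟩
      exact h s hs
  have hFixc : IsClosed {U : Site d → Fin d → (Matrix n n ℂ)ˣ | ∀ w ∈ 𝒲, gaugeAct w U = U} := isClosed_fixedSet 𝒲
  -- the window-good set and its complement
  set Good : Set (Site d → Fin d → (Matrix n n ℂ)ˣ) := {U | ∀ x ∈ periodBox (d := d) Pd, ∀ κ κ' : Fin d, κ ≠ κ' →
    ‖((hol U x (plaqWord κ κ') : (Matrix n n ℂ)ˣ) : Matrix n n ℂ) - 1‖ < r} with hGood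
  have hGoodo : IsOpen Good := isOpen_goodSet (d := d) (n := n) Pd r
  have hBadc : IsClosed Goodᶜ := hGoodo.isClosed_compl
  have hgood_small : ∀ U ∈ sfClass d L N ε (k + 1), U ∈ Good → SmallField U r := by
    intro U hU hUg
    exact smallField_of_window (P := Pd) hU.2.1 fun x hx κ κ' hκ => (hUg x hx κ κ' hκ).le
  have hbad_not : ∀ U : Site d → Fin d → (Matrix n n ℂ)ˣ, U ∉ Good → ¬ SmallField U r₁ := by
    intro U hUb hUr₁
    apply hUb
    intro x hx κ κ' hκ
    exact lt_of_le_of_lt (hUr₁ x κ κ' hκ) hr₁r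
  -- (A) the gap on the bad part of the fibre at `τ₀` (VERBATIM: ALL-SMALL speaks of every admissible configuration)
  have hgap : ∃ ε' : ℝ, 0 < ε' ∧ ∀ U ∈ admissible (sfClass d L N ε) L (k + 1) (γ τ₀), U ∉ Good → m₀ + ε' ≤ f U := by
    set G : Set (Site d → Fin d → (Matrix n n ℂ)ˣ) := admissible (sfClass d L N ε) L (k + 1) (γ τ₀) ∩ Goodᶜ with hG
    have hGc : IsCompact G := (isCompact_admissible hL hε0 hε1 hε2 N (k + 1) (γ τ₀)).inter_right hBadc
    have hpos : ∀ U ∈ G, m₀ < f U := by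
      intro U hU
      by_contra hle
      exact hbad_not U hU.2 (hall U hU.1 (not_lt.mp hle))
    rcases G.eq_empty_or_nonempty with hGe | hGne
    · refine ⟨1, one_pos, fun U hU hUb => ?_⟩
      have : U ∈ G := ⟨hU, hUb⟩
      rw [hGe] at this
      exact absurd this (Set.notMem_empty U)
    · obtain ⟨U₁, hU₁G, hU₁min⟩ := hGc.exists_isMinOn hGne hfc.continuousOn
      refine ⟨f U₁ - m₀, by linarith [hpos U₁ hU₁G], fun U hU hUb => ?_⟩
      have h := hU₁min (show U ∈ G from ⟨hU, hUb⟩)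
      simp only [mem_setOf_eq] at h
      linarith
  obtain ⟨ε', hε', hgap'⟩ := hgap
  -- (B) the parameters carrying a cheap bad admissible configuration form a closed set avoiding `τ₀` (VERBATIM)
  set T : Set ℝ := {τ : ℝ | τ ∈ Icc (0 : ℝ) 1 ∧ ∃ U : Site d → Fin d → (Matrix n n ℂ)ˣ,
    U ∈ admissible (sfClass d L N ε) L (k + 1) (γ τ) ∧ SmallField U (ε / ((L : ℝ) ^ (k + 1)) ^ 2) ∧ (U ∈ Goodᶜ ∧ f U ≤ m₀ + ε' / 2)} with hT
  have hTcl : IsClosed T := by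
    have hcc : IsClosed {U : Site d → Fin d → (Matrix n n ℂ)ˣ | U ∈ sfClass d L N ε (k + 1) ∧ (U ∈ Goodᶜ ∧ f U ≤ m₀ + ε' / 2)} := by
      have e : {U : Site d → Fin d → (Matrix n n ℂ)ˣ | U ∈ sfClass d L N ε (k + 1) ∧ (U ∈ Goodᶜ ∧ f U ≤ m₀ + ε' / 2)}
          = sfClass d L N ε (k + 1) ∩ (Goodᶜ ∩ {U | f U ≤ m₀ + ε' / 2}) := by ext U; simp only [mem_setOf_eq, mem_inter_iff]
      rw [e]
      exact (isCompact_sfClass (d := d) (n := n) L N ε (k + 1)).isClosed.inter (hBadc.inter (isClosed_le hfc continuous_const))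
    rw [hT]
    exact isClosed_critSet_param' hL hε0 hε1 hε2 γ hγ (fun U => U ∈ Goodᶜ ∧ f U ≤ m₀ + ε' / 2) hcc
  have hτ₀T : τ₀ ∉ T := by
    rintro ⟨-, U, hU, -, hUb, hUf⟩
    have h := hgap' U hU hUb
    linarith
  obtain ⟨ρ₁, hρ₁, hball₁⟩ : ∃ ρ₁ > 0, Metric.ball τ₀ ρ₁ ⊆ Tᶜ := Metric.mem_nhds_iff.mp (hTcl.isOpen_compl.mem_nhds hτ₀T)
  -- (C) SYMMETRIC lower hemicontinuity at the interior fixed point `U₀`: cheap FIXED admissible configurations nearby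
  have h𝒰 : {U : Site d → Fin d → (Matrix n n ℂ)ˣ | f U < m₀ + ε' / 2} ∈ 𝓝 U₀ :=
    (isOpen_lt hfc continuous_const).mem_nhds (by show f U₀ < m₀ + ε' / 2; rw [hm₀]; linarith)
  have hlhc := symmetric_admissible_lhc_param (N := N) (k := k) hL1 hε0 hls (hγ.continuousWithinAt hτ₀) hγu hγP K hKu hKP hγK hU₀ hr₁ε hU₀r₁
    hU₀fix h𝒰
  obtain ⟨ρ₂, hρ₂, hball₂⟩ := Metric.mem_nhdsWithin_iff.mp hlhc
  -- (D) assemble: the fixed admissible set is non-empty and compact, restricted minimisers exist and are good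
  refine ⟨min ρ₁ ρ₂, lt_min hρ₁ hρ₂, fun τ hτI hτρ => ?_⟩
  have hτ1 : τ ∈ Metric.ball τ₀ ρ₁ := by rw [Metric.mem_ball, Real.dist_eq]; exact lt_of_lt_of_le hτρ (min_le_left _ _)
  have hτ2 : τ ∈ Metric.ball τ₀ ρ₂ := by rw [Metric.mem_ball, Real.dist_eq]; exact lt_of_lt_of_le hτρ (min_le_right _ _)
  obtain ⟨V₁, hV₁f, hV₁adm, hV₁fix⟩ := hball₂ ⟨hτ2, hτI⟩
  have hτT : τ ∉ T := hball₁ hτ1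
  have hsmall : ∀ U, U ∈ admissible (sfClass d L N ε) L (k + 1) (γ τ) →
      (∀ s ∈ K, gaugeAct (fun x : Site d => s (fun i => x i / ((L : ℤ) ^ (k + 1)))) U = U) →
      (∀ U' ∈ admissible (sfClass d L N ε) L (k + 1) (γ τ),
        (∀ s ∈ K, gaugeAct (fun x : Site d => s (fun i => x i / ((L : ℤ) ^ (k + 1)))) U' = U') →
          levelAction d L N (k + 1) U ≤ levelAction d L N (k + 1) U') → SmallField U r := by
    intro U hU _ hUmin
    have hUf : f U ≤ m₀ + ε' / 2 := (hUmin V₁ hV₁adm hV₁fix).trans (le_of_lt hV₁f)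
    have hUgood : U ∈ Good := by
      by_contra hUb
      exact hτT ⟨hτI, U, hU, hU.1.2.2, hUb, hUf⟩
    exact hgood_small U hU.1 hUgood
  refine ⟨?_, hsmall⟩
  set A : Set (Site d → Fin d → (Matrix n n ℂ)ˣ) := admissible (sfClass d L N ε) L (k + 1) (γ τ) ∩
    {U | ∀ w ∈ 𝒲, gaugeAct w U = U} with hA
  have hAc : IsCompact A := (isCompact_admissible hL hε0 hε1 hε2 N (k + 1) (γ τ)).inter_right hFixc
  have hAne : A.Nonempty := ⟨V₁, hV₁adm, (hfixW V₁).mpr hV₁fix⟩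
  obtain ⟨U, hUA, hUmin⟩ := hAc.exists_isMinOn hAne hfc.continuousOn
  refine ⟨U, hUA.1, (hfixW U).mp hUA.2, fun U' hU' hU'fix => ?_⟩
  have h := hUmin (show U' ∈ A from ⟨hU', (hfixW U').mpr hU'fix⟩)
  simpa only [mem_setOf_eq] using h

/-- **(OPEN_K) AT ONE PARAMETER FROM (APE) ∧ (ALL-SMALL) AT THAT PARAMETER** — the relatively-open half of the SYMMETRIC continuity method in the exact shape of
✓ `NE7StabiliserLiftingUniformEnd.fixedCrit_of_continuity` (radius `r` KEPT, tangent criticality, fixedness by the lifts of `K`), by RESTRICTED minimisation: the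
hypotheses of `exists_fixedMinimiser_small_near` with `0 ≤ r₁ < r < ε(L^{k+1})^{−2}`, where the small fixed configuration `U₀` at `τ₀` is obtained from a `SmallField · r`
tangent-critical admissible fixed one by (APE), and ALL-SMALL is asked of it (both letters VERBATIM the road's); the produced configurations are the restricted
minimisers, tangent-critical by restricted Fermat + Palais (✓ `tanCritical_of_symmetricRestrictedMinimiser`). [folklore] -/
theorem symmetric_open_of_ape_allSmall [Nonempty n] {L N k : ℕ} [NeZero L] [NeZero N] (hL : 2 ≤ L) {ε r r₁ : ℝ} (hε0 : 0 ≤ ε)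
    (hε1 : 16 * C0 d * ε ≤ 3) (hε2 : 1024 * (d + 1) * (d + 4) * (L : ℝ) ^ 2 * ε ≤ 1) (hls : LevelSmall d L k (ε / ((L : ℝ) ^ (k + 1)) ^ 2))
    (hr₁ : 0 ≤ r₁) (hr₁r : r₁ < r) (hrε : r < ε / ((L : ℝ) ^ (k + 1)) ^ 2)
    (K : Set (Site d → (Matrix n n ℂ)ˣ)) (hKu : ∀ s ∈ K, IsUnitarySite s) (hKP : ∀ s ∈ K, IsPeriodicSite s (N : ℤ))
    (γ : ℝ → (Site d → Fin d → (Matrix n n ℂ)ˣ)) (hγ : ContinuousOn γ (Icc (0 : ℝ) 1)) (hγu : ∀ τ ∈ Icc (0 : ℝ) 1, IsUnitaryCfg (γ τ))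
    (hγP : ∀ τ ∈ Icc (0 : ℝ) 1, IsPeriodicCfg (γ τ) (N : ℤ)) (hγK : ∀ τ ∈ Icc (0 : ℝ) 1, ∀ s ∈ K, gaugeAct s (γ τ) = γ τ)
    {τ₀ : ℝ} (hτ₀ : τ₀ ∈ Icc (0 : ℝ) 1)
    (hape : ∀ U ∈ admissible (sfClass d L N ε) L (k + 1) (γ τ₀), SmallField U r →
      (∀ φ : Site d → Fin d → Matrix n n ℂ, IsSkewDir φ → IsPeriodicDir φ ((N * L ^ (k + 1) : ℕ) : ℤ) → TangentIter L k U φ →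
        dAction U φ (perWin d (N * L ^ (k + 1))) = 0) → SmallField U r₁)
    (hall : ∀ U₀ ∈ admissible (sfClass d L N ε) L (k + 1) (γ τ₀), SmallField U₀ r₁ →
      (∀ φ : Site d → Fin d → Matrix n n ℂ, IsSkewDir φ → IsPeriodicDir φ ((N * L ^ (k + 1) : ℕ) : ℤ) → TangentIter L k U₀ φ →
        dAction U₀ φ (perWin d (N * L ^ (k + 1))) = 0) →
      ∀ U ∈ admissible (sfClass d L N ε) L (k + 1) (γ τ₀), levelAction d L N (k + 1) U ≤ levelAction d L N (k + 1) U₀ → SmallField U r₁)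
    (h0 : ∃ U : Site d → Fin d → (Matrix n n ℂ)ˣ, U ∈ admissible (sfClass d L N ε) L (k + 1) (γ τ₀) ∧ SmallField U r ∧
      (∀ φ : Site d → Fin d → Matrix n n ℂ, IsSkewDir φ → IsPeriodicDir φ ((N * L ^ (k + 1) : ℕ) : ℤ) → TangentIter L k U φ →
        dAction U φ (perWin d (N * L ^ (k + 1))) = 0) ∧
      ∀ s ∈ K, gaugeAct (fun x : Site d => s (fun i => x i / ((L : ℤ) ^ (k + 1)))) U = U) :
    ∃ ρ : ℝ, 0 < ρ ∧ ∀ τ ∈ Icc (0 : ℝ) 1, |τ - τ₀| < ρ →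
      ∃ U : Site d → Fin d → (Matrix n n ℂ)ˣ, U ∈ admissible (sfClass d L N ε) L (k + 1) (γ τ) ∧ SmallField U r ∧
        (∀ φ : Site d → Fin d → Matrix n n ℂ, IsSkewDir φ → IsPeriodicDir φ ((N * L ^ (k + 1) : ℕ) : ℤ) → TangentIter L k U φ →
          dAction U φ (perWin d (N * L ^ (k + 1))) = 0) ∧
        ∀ s ∈ K, gaugeAct (fun x : Site d => s (fun i => x i / ((L : ℤ) ^ (k + 1)))) U = U := by
  have hL1 : 1 ≤ L := by omega
  obtain ⟨U₀, hU₀, hU₀r, hU₀crit, hU₀fix⟩ := h0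
  have hU₀r₁ : SmallField U₀ r₁ := hape U₀ hU₀ hU₀r hU₀crit
  have hr₁ε : r₁ < ε / ((L : ℝ) ^ (k + 1)) ^ 2 := hr₁r.trans hrε
  obtain ⟨ρ, hρ, hnear⟩ := exists_fixedMinimiser_small_near hL hε0 hε1 hε2 hls hr₁r hr₁ε K hKu hKP γ hγ hγu hγP hγK hτ₀ hU₀ hU₀r₁ hU₀fix
    (hall U₀ hU₀ hU₀r₁ hU₀crit)
  refine ⟨ρ, hρ, fun τ hτI hτρ => ?_⟩
  obtain ⟨⟨U, hU, hUfix, hUmin⟩, hsmall⟩ := hnear τ hτI hτρ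
  have hUr : SmallField U r := hsmall U hU hUfix hUmin
  exact ⟨U, hU, hUr, tanCritical_of_symmetricRestrictedMinimiser hL1 hε0 hU K hKu hKP hUfix hUmin (hr₁.trans hr₁r.le) hrε hUr hls, hUfix⟩

/-- **THE (OPEN_K) BINDER OF ✓ `NE7StabiliserLiftingUniformEnd.fixed_minimiser_of_open_path` FROM (APE)^path ∧ (ALL-SMALL)^path** (both quantified over the
data path, exactly F27's `hopen_of_ape_allSmall` letters). [folklore] -/
theorem symmetric_hopen_of_ape_allSmall [Nonempty n] {L N k : ℕ} [NeZero L] [NeZero N] (hL : 2 ≤ L) {ε r r₁ : ℝ} (hε0 : 0 ≤ ε)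
    (hε1 : 16 * C0 d * ε ≤ 3) (hε2 : 1024 * (d + 1) * (d + 4) * (L : ℝ) ^ 2 * ε ≤ 1) (hls : LevelSmall d L k (ε / ((L : ℝ) ^ (k + 1)) ^ 2))
    (hr₁ : 0 ≤ r₁) (hr₁r : r₁ < r) (hrε : r < ε / ((L : ℝ) ^ (k + 1)) ^ 2)
    (K : Set (Site d → (Matrix n n ℂ)ˣ)) (hKu : ∀ s ∈ K, IsUnitarySite s) (hKP : ∀ s ∈ K, IsPeriodicSite s (N : ℤ))
    (γ : ℝ → (Site d → Fin d → (Matrix n n ℂ)ˣ)) (hγ : ContinuousOn γ (Icc (0 : ℝ) 1)) (hγu : ∀ τ ∈ Icc (0 : ℝ) 1, IsUnitaryCfg (γ τ))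
    (hγP : ∀ τ ∈ Icc (0 : ℝ) 1, IsPeriodicCfg (γ τ) (N : ℤ)) (hγK : ∀ τ ∈ Icc (0 : ℝ) 1, ∀ s ∈ K, gaugeAct s (γ τ) = γ τ)
    (hape : ∀ τ ∈ Icc (0 : ℝ) 1, ∀ U ∈ admissible (sfClass d L N ε) L (k + 1) (γ τ), SmallField U r →
      (∀ φ : Site d → Fin d → Matrix n n ℂ, IsSkewDir φ → IsPeriodicDir φ ((N * L ^ (k + 1) : ℕ) : ℤ) → TangentIter L k U φ →
        dAction U φ (perWin d (N * L ^ (k + 1))) = 0) → SmallField U r₁)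
    (hall : ∀ τ ∈ Icc (0 : ℝ) 1, ∀ U₀ ∈ admissible (sfClass d L N ε) L (k + 1) (γ τ), SmallField U₀ r₁ →
      (∀ φ : Site d → Fin d → Matrix n n ℂ, IsSkewDir φ → IsPeriodicDir φ ((N * L ^ (k + 1) : ℕ) : ℤ) → TangentIter L k U₀ φ →
        dAction U₀ φ (perWin d (N * L ^ (k + 1))) = 0) →
      ∀ U ∈ admissible (sfClass d L N ε) L (k + 1) (γ τ), levelAction d L N (k + 1) U ≤ levelAction d L N (k + 1) U₀ → SmallField U r₁) :
    ∀ τ₀ ∈ Icc (0 : ℝ) 1,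
      (∃ U : Site d → Fin d → (Matrix n n ℂ)ˣ, U ∈ admissible (sfClass d L N ε) L (k + 1) (γ τ₀) ∧ SmallField U r ∧
        (∀ φ : Site d → Fin d → Matrix n n ℂ, IsSkewDir φ → IsPeriodicDir φ ((N * L ^ (k + 1) : ℕ) : ℤ) → TangentIter L k U φ →
          dAction U φ (perWin d (N * L ^ (k + 1))) = 0) ∧
        ∀ s ∈ K, gaugeAct (fun x : Site d => s (fun i => x i / ((L : ℤ) ^ (k + 1)))) U = U) →
      ∃ ρ : ℝ, 0 < ρ ∧ ∀ τ ∈ Icc (0 : ℝ) 1, |τ - τ₀| < ρ →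
        ∃ U : Site d → Fin d → (Matrix n n ℂ)ˣ, U ∈ admissible (sfClass d L N ε) L (k + 1) (γ τ) ∧ SmallField U r ∧
          (∀ φ : Site d → Fin d → Matrix n n ℂ, IsSkewDir φ → IsPeriodicDir φ ((N * L ^ (k + 1) : ℕ) : ℤ) → TangentIter L k U φ →
            dAction U φ (perWin d (N * L ^ (k + 1))) = 0) ∧
          ∀ s ∈ K, gaugeAct (fun x : Site d => s (fun i => x i / ((L : ℤ) ^ (k + 1)))) U = U :=
  fun τ₀ hτ₀ h0 => symmetric_open_of_ape_allSmall hL hε0 hε1 hε2 hls hr₁ hr₁r hrε K hKu hKP γ hγ hγu hγP hγK hτ₀ (hape τ₀ hτ₀) (hall τ₀ hτ₀) h0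

end

end Summit.QuantumFields.BalabanUV.T4Continuum.NE7SymmetricOpenOfMinimisation
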